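import Summits.AtomisticToContinuum.HydrodynamicLimit.Theorems.BoltzmannGreenKubo.Negative.TimeAverage
import Literature.Probability.Process.ProgressiveDensity

/-!
# The kinetic-window variance is the double time integral of the STATIONARY two-time covariance

Infrastructure for the crux `AntiMazurCoboundaries.BoltzmannGreenKubo` (stmt-AtomisticToContinuum-13985), from the standing
disprover's `Cruxes/BoltzmannGreenKubo/Disproof.lean` §2e (gen 2) — the bookkeeping identity every line of attack on the crux
starts from (ideators' S1), with the joint-measurability / Fubini / stationarity debts DISCHARGED: for the constant-profile
Gibbs law `G_N` (any `N`, `σ`, flow `Φ`, provided `G_N` is a probability measure), every bounded measurable observable `X` and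
every window `h ≥ 0`,
`∫ (∫₀ʰ X(Φ_r z) dr)² dG_N = ∫₀ʰ ∫₀ʰ C(|r' − r|) dr' dr`, `C(t) = ∫ X(z) X(Φ_t z) dG_N` (`integral_sq_window_eq_double`),
the two-time identity being `∫ X(Φ_r z) X(Φ_{r'} z) dG_N = C(r' − r) = C(|r' − r|)` (`integral_mul_flow_flow_sub`,
`cov_neg`, `integral_mul_flow_flow`: group property on the good set + invariance of `G_N`, `Negative/Stationarity`). No positivity of `σ`, no dynamics beyond the `HardSphereFlow` axioms.
This is neutral (neither positive nor negative) knowledge: it is what converts the crux into a statement about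
`sup_{t ≤ h} |C_N(t) − C_B(t)|` plus domination, and what every finite-`N` floor / ceiling in this directory instantiates.
refuter-cdisprove-stmt-AtomisticToContinuum-13985-g2-0.
-/

noncomputable section

namespace Summit.AtomisticToContinuum.HydrodynamicLimit.Theorems

open MeasureTheory ProbabilityTheory Filter Topology Set
open Literature.Analysis.FluidPDE Literature.MathematicalPhysics.KineticTheory
open Literature.Analysis.UnboundedOperators
open scoped InnerProductSpace
open BoltzmannGreenKuboOrthMomentum

namespace BoltzmannGreenKuboWindowCovariance

variable {σ : ℝ} {N : ℕ}

/-- The stationary two-time covariance `C(t) = ∫ X(z) X(Φ_t z) dG_N`. [folklore] -/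
def cov (Φ : HardSphereFlow (Torus.geometry (Fin 3)) (hsDiameter σ N) (N + 1))
    (X : Config (N + 1) (Fin 3) T3 → ℝ) (t : ℝ) : ℝ :=
  ∫ z, X z * X (Φ.flow t z) ∂(localGibbsLaw σ (fun _ => 1) (fun _ => 0) (fun _ => 1) N Φ)

/-- **Two-time stationarity**: `∫ X(Φ_r z) X(Φ_{r'} z) dG_N = C(r' − r)` for ALL `r, r'` (group property on the good set —
valid for all real times — and invariance of `G_N` under `Φ_r`). [folklore] -/
theorem integral_mul_flow_flow_sub (Φ : HardSphereFlow (Torus.geometry (Fin 3)) (hsDiameter σ N) (N + 1))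
    {X : Config (N + 1) (Fin 3) T3 → ℝ} (hX : Measurable X) (r r' : ℝ) :
    ∫ z, X (Φ.flow r z) * X (Φ.flow r' z) ∂(localGibbsLaw σ (fun _ => 1) (fun _ => 0) (fun _ => 1) N Φ) =
      cov Φ X (r' - r) := by
  set G := localGibbsLaw σ (fun _ => (1 : ℝ)) (fun _ => (0 : V3)) (fun _ => (1 : ℝ)) N Φ with hGdef
  have hae : (fun z => X (Φ.flow r z) * X (Φ.flow r' z)) =ᵐ[G]
      fun z => (fun w => X w * X (Φ.flow (r' - r) w)) (Φ.flow r z) := by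
    filter_upwards [ae_mem_good_localGibbsLaw' (N := N) 1 1 0 Φ] with z hz
    have key : Φ.flow r' z = Φ.flow (r' - r) (Φ.flow r z) := by
      have := Φ.flow_add (r' - r) r z hz
      rwa [sub_add_cancel] at this
    simp only [key]
  rw [integral_congr_ae hae]
  have hF : AEStronglyMeasurable (fun w => X w * X (Φ.flow (r' - r) w)) (G.map (Φ.flow r)) :=
    (hX.mul (hX.comp (Φ.measurable_flow _))).aestronglyMeasurable
  have h := integral_map (Φ.measurable_flow r).aemeasurable hF
  rw [(measurePreserving_flow_localGibbsLaw 1 1 0 Φ r).map_eq] at h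
  rw [← h]
  rfl

/-- **The stationary covariance is even**: `C(−t) = C(t)`. [folklore] -/
theorem cov_neg (Φ : HardSphereFlow (Torus.geometry (Fin 3)) (hsDiameter σ N) (N + 1))
    {X : Config (N + 1) (Fin 3) T3 → ℝ} (hX : Measurable X) (t : ℝ) : cov Φ X (-t) = cov Φ X t := by
  have h1 := integral_mul_flow_flow_sub Φ hX t 0
  have h2 := integral_mul_flow_flow_sub Φ hX 0 t
  rw [zero_sub] at h1
  rw [sub_zero] at h2
  rw [← h1, ← h2]
  simp_rw [mul_comm (X (Φ.flow t _))]

/-- **Two-time stationarity, normal form**: `∫ X(Φ_r z) X(Φ_{r'} z) dG_N = C(|r' − r|)`. [folklore] -/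
theorem integral_mul_flow_flow (Φ : HardSphereFlow (Torus.geometry (Fin 3)) (hsDiameter σ N) (N + 1))
    {X : Config (N + 1) (Fin 3) T3 → ℝ} (hX : Measurable X) (r r' : ℝ) :
    ∫ z, X (Φ.flow r z) * X (Φ.flow r' z) ∂(localGibbsLaw σ (fun _ => 1) (fun _ => 0) (fun _ => 1) N Φ) =
      cov Φ X |r' - r| := by
  rw [integral_mul_flow_flow_sub Φ hX r r']
  rcases le_total r r' with h | h
  · rw [abs_of_nonneg (sub_nonneg.2 h)]
  · rw [abs_of_nonpos (sub_nonpos.2 h), cov_neg Φ hX]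

/-- The square of an interval integral is a double interval integral (no integrability needed: Bochner linearity). [folklore] -/
theorem sq_intervalIntegral (f : ℝ → ℝ) (a b : ℝ) :
    (∫ r in a..b, f r) ^ 2 = ∫ r in a..b, ∫ r' in a..b, f r * f r' := by
  rw [sq, ← intervalIntegral.integral_mul_const]
  refine intervalIntegral.integral_congr fun r _ => ?_
  exact (intervalIntegral.integral_const_mul (f r) f).symm

/-- A jointly measurable modification of the two-time integrand `((z, r), r') ↦ X(Φ_r z) X(Φ_{r'} z)`. [folklore] -/
theorem aestronglyMeasurable_two_time (Φ : HardSphereFlow (Torus.geometry (Fin 3)) (hsDiameter σ N) (N + 1))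
    {X : Config (N + 1) (Fin 3) T3 → ℝ} (hX : Measurable X) (μ ν : Measure ℝ) [SFinite μ] [SFinite ν] :
    AEStronglyMeasurable (fun p : (Config (N + 1) (Fin 3) T3 × ℝ) × ℝ => X (Φ.flow p.1.2 p.1.1) * X (Φ.flow p.2 p.1.1))
      (((localGibbsLaw σ (fun _ => 1) (fun _ => 0) (fun _ => 1) N Φ).prod μ).prod ν) := by
  set G := localGibbsLaw σ (fun _ => (1 : ℝ)) (fun _ => (0 : V3)) (fun _ => (1 : ℝ)) N Φ with hGdef
  have hM : Measurable fun p : (Config (N + 1) (Fin 3) T3 × ℝ) × ℝ =>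
      X (flowMod Φ (p.1.2, p.1.1)) * X (flowMod Φ (p.2, p.1.1)) :=
    (hX.comp ((measurable_flowMod Φ).comp (measurable_fst.snd.prodMk measurable_fst.fst))).mul
      (hX.comp ((measurable_flowMod Φ).comp (measurable_snd.prodMk measurable_fst.fst)))
  refine ⟨_, hM.stronglyMeasurable, ?_⟩
  have hnull : ((G.prod μ).prod ν) ((Φ.goodᶜ ×ˢ (Set.univ : Set ℝ)) ×ˢ (Set.univ : Set ℝ)) = 0 := by
    rw [Measure.prod_prod, Measure.prod_prod, localGibbsLaw_compl_good 1 1 0 Φ, zero_mul, zero_mul]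
  have hae : ∀ᵐ p ∂((G.prod μ).prod ν), p.1.1 ∈ Φ.good := by
    rw [ae_iff]
    refine measure_mono_null (fun p hp => ?_) hnull
    exact ⟨⟨hp, Set.mem_univ _⟩, Set.mem_univ _⟩
  filter_upwards [hae] with p hp
  simp only [flowMod_of_mem Φ hp]

/-- The two-time integrand with one time frozen is a.e.-strongly measurable on `G_N ⊗ ν`. [folklore] -/
theorem aestronglyMeasurable_two_time_fixed (Φ : HardSphereFlow (Torus.geometry (Fin 3)) (hsDiameter σ N) (N + 1))
    {X : Config (N + 1) (Fin 3) T3 → ℝ} (hX : Measurable X) (r : ℝ) (ν : Measure ℝ) [SFinite ν] :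
    AEStronglyMeasurable (fun q : Config (N + 1) (Fin 3) T3 × ℝ => X (Φ.flow r q.1) * X (Φ.flow q.2 q.1))
      ((localGibbsLaw σ (fun _ => 1) (fun _ => 0) (fun _ => 1) N Φ).prod ν) := by
  set G := localGibbsLaw σ (fun _ => (1 : ℝ)) (fun _ => (0 : V3)) (fun _ => (1 : ℝ)) N Φ with hGdef
  have hM : Measurable fun q : Config (N + 1) (Fin 3) T3 × ℝ =>
      X (flowMod Φ (r, q.1)) * X (flowMod Φ (q.2, q.1)) :=
    (hX.comp ((measurable_flowMod Φ).comp (measurable_const.prodMk measurable_fst))).mul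
      (hX.comp ((measurable_flowMod Φ).comp (measurable_snd.prodMk measurable_fst)))
  refine ⟨_, hM.stronglyMeasurable, ?_⟩
  have hnull : (G.prod ν) (Φ.goodᶜ ×ˢ (Set.univ : Set ℝ)) = 0 := by
    rw [Measure.prod_prod, localGibbsLaw_compl_good 1 1 0 Φ, zero_mul]
  have hae : ∀ᵐ q ∂(G.prod ν), q.1 ∈ Φ.good := by
    rw [ae_iff]
    refine measure_mono_null (fun q hq => ?_) hnull
    exact ⟨hq, Set.mem_univ _⟩
  filter_upwards [hae] with q hq
  simp only [flowMod_of_mem Φ hq]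

/-- **THE WINDOW-VARIANCE IDENTITY.** For a probability Gibbs law `G_N`, a bounded measurable observable `X` and `h ≥ 0`:
`∫ (∫₀ʰ X(Φ_r z) dr)² dG_N = ∫₀ʰ ∫₀ʰ C(|r' − r|) dr' dr` with `C(t) = ∫ X(z) X(Φ_t z) dG_N` — Bochner linearity for the
square, Fubini twice (bounded integrand, finite measures, jointly measurable modification of the flow), two-time
stationarity pointwise in `(r, r')`. [folklore] -/
theorem integral_sq_window_eq_double (Φ : HardSphereFlow (Torus.geometry (Fin 3)) (hsDiameter σ N) (N + 1))
    [IsProbabilityMeasure (localGibbsLaw σ (fun _ => 1) (fun _ => 0) (fun _ => 1) N Φ)]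
    {X : Config (N + 1) (Fin 3) T3 → ℝ} (hX : Measurable X) {K : ℝ} (hXb : ∀ z, |X z| ≤ K) {h : ℝ} (hh : 0 ≤ h) :
    ∫ z, (∫ r in (0 : ℝ)..h, X (Φ.flow r z)) ^ 2 ∂(localGibbsLaw σ (fun _ => 1) (fun _ => 0) (fun _ => 1) N Φ) =
      ∫ r in (0 : ℝ)..h, ∫ r' in (0 : ℝ)..h, cov Φ X |r' - r| := by
  set G := localGibbsLaw σ (fun _ => (1 : ℝ)) (fun _ => (0 : V3)) (fun _ => (1 : ℝ)) N Φ with hGdef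
  set μ : Measure ℝ := volume.restrict (Ioc (0 : ℝ) h) with hμ
  haveI : IsFiniteMeasure μ := by
    rw [hμ]
    exact ⟨by simp [Real.volume_Ioc]⟩
  have hK : 0 ≤ K := (abs_nonneg _).trans (hXb (Φ.flow 0 (fun _ => (0, 0))))
  -- the bounded, a.e.-measurable two-time integrand on the triple product
  have hbd : ∀ p : (Config (N + 1) (Fin 3) T3 × ℝ) × ℝ, ‖X (Φ.flow p.1.2 p.1.1) * X (Φ.flow p.2 p.1.1)‖ ≤ K * K := by
    intro p
    rw [Real.norm_eq_abs, abs_mul]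
    exact mul_le_mul (hXb _) (hXb _) (abs_nonneg _) hK
  have hI3 : Integrable (fun p : (Config (N + 1) (Fin 3) T3 × ℝ) × ℝ => X (Φ.flow p.1.2 p.1.1) * X (Φ.flow p.2 p.1.1))
      ((G.prod μ).prod μ) :=
    (integrable_const (K * K)).mono' (aestronglyMeasurable_two_time Φ hX μ μ) (Eventually.of_forall hbd)
  have hI2 : ∀ r : ℝ, Integrable (fun q : Config (N + 1) (Fin 3) T3 × ℝ => X (Φ.flow r q.1) * X (Φ.flow q.2 q.1))
      (G.prod μ) := fun r =>
    (integrable_const (K * K)).mono' (aestronglyMeasurable_two_time_fixed Φ hX r μ)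
      (Eventually.of_forall fun q => by
        rw [Real.norm_eq_abs, abs_mul]
        exact mul_le_mul (hXb _) (hXb _) (abs_nonneg _) hK)
  -- step 1: square → double time integral, pointwise in z
  have h1 : ∀ z, (∫ r in (0 : ℝ)..h, X (Φ.flow r z)) ^ 2 =
      ∫ r in (0 : ℝ)..h, ∫ r' in (0 : ℝ)..h, X (Φ.flow r z) * X (Φ.flow r' z) := fun z =>
    sq_intervalIntegral (fun r => X (Φ.flow r z)) 0 h
  simp_rw [h1]
  simp only [intervalIntegral.integral_of_le hh]
  -- step 2: swap `∫ dG` with the outer `∫ dr`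
  have hswap1 : ∫ z, ∫ r, ∫ r', X (Φ.flow r z) * X (Φ.flow r' z) ∂μ ∂μ ∂G =
      ∫ r, ∫ z, ∫ r', X (Φ.flow r z) * X (Φ.flow r' z) ∂μ ∂G ∂μ := by
    refine integral_integral_swap ?_
    have := hI3.integral_prod_left
    exact this
  rw [hswap1]
  -- step 3: swap `∫ dG` with the inner `∫ dr'`, for each `r`, then stationarity pointwise
  refine integral_congr_ae (Eventually.of_forall fun r => ?_)
  simp only
  have hswap2 : ∫ z, ∫ r', X (Φ.flow r z) * X (Φ.flow r' z) ∂μ ∂G =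
      ∫ r', ∫ z, X (Φ.flow r z) * X (Φ.flow r' z) ∂G ∂μ :=
    integral_integral_swap (hI2 r)
  rw [hswap2]
  refine integral_congr_ae (Eventually.of_forall fun r' => ?_)
  exact integral_mul_flow_flow Φ hX r r'

/-! ### The triangle reduction `∫₀ʰ∫₀ʰ f(|r' − r|) dr' dr = 2∫₀ʰ (h − t) f(t) dt` (pure real analysis) -/

/-- Inner split: `∫₀ʰ f(|r' − r|) dr' = ∫₀ʳ f + ∫₀^{h−r} f` for `0 ≤ r ≤ h`. [folklore] -/
theorem integral_abs_sub_split {f : ℝ → ℝ} (hf : Measurable f) {M : ℝ} (hb : ∀ t, |f t| ≤ M) {h r : ℝ}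
    (hr0 : 0 ≤ r) (hrh : r ≤ h) :
    ∫ r' in (0 : ℝ)..h, f |r' - r| = (∫ t in (0 : ℝ)..r, f t) + ∫ t in (0 : ℝ)..(h - r), f t := by
  have hm : Measurable fun r' : ℝ => f |r' - r| := hf.comp ((measurable_id.sub measurable_const).abs)
  have hii : ∀ a b : ℝ, IntervalIntegrable (fun r' => f |r' - r|) volume a b := fun a b =>
    Literature.Probability.Process.intervalIntegrable_of_bdd hm (fun r' => hb _) a b
  rw [← intervalIntegral.integral_add_adjacent_intervals (hii 0 r) (hii r h)]
  congr 1
  · rw [intervalIntegral.integral_congr (g := fun r' => f (r - r')) (fun r' hr' => ?_)]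
    · rw [intervalIntegral.integral_comp_sub_left (fun x => f x) r]
      simp
    · rw [Set.uIcc_of_le hr0] at hr'
      simp only
      rw [abs_of_nonpos (sub_nonpos.2 hr'.2), neg_sub]
  · rw [intervalIntegral.integral_congr (g := fun r' => f (r' - r)) (fun r' hr' => ?_)]
    · rw [intervalIntegral.integral_comp_sub_right (fun x => f x) r]
      simp
    · rw [Set.uIcc_of_le hrh] at hr'
      simp only
      rw [abs_of_nonneg (sub_nonneg.2 hr'.1)]

/-- Fubini on the triangle: `∫₀ʰ (∫₀ᵘ f) du = ∫₀ʰ (h − t) f(t) dt`. [folklore] -/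
theorem integral_primitive_eq {f : ℝ → ℝ} (hf : Measurable f) {M : ℝ} (hb : ∀ t, |f t| ≤ M) {h : ℝ} (hh : 0 ≤ h) :
    ∫ u in (0 : ℝ)..h, (∫ t in (0 : ℝ)..u, f t) = ∫ t in (0 : ℝ)..h, (h - t) * f t := by
  set μ : Measure ℝ := volume.restrict (Ioc (0 : ℝ) h) with hμ
  haveI : IsFiniteMeasure μ := by
    rw [hμ]
    exact ⟨by simp [Real.volume_Ioc]⟩
  rw [intervalIntegral.integral_of_le hh, intervalIntegral.integral_of_le hh]
  have hL : ∫ u in Ioc (0 : ℝ) h, (∫ t in (0 : ℝ)..u, f t) =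
      ∫ u in Ioc (0 : ℝ) h, ∫ t in Ioc (0 : ℝ) h, (Iic u).indicator f t := by
    refine setIntegral_congr_fun measurableSet_Ioc fun u hu => ?_
    have hset : Ioc (0 : ℝ) h ∩ Iic u = Ioc 0 u := by
      ext t
      simp only [Set.mem_Ioc, Set.mem_inter_iff, Set.mem_Iic]
      exact ⟨fun ⟨⟨h1, _⟩, h3⟩ => ⟨h1, h3⟩, fun ⟨h1, h2⟩ => ⟨⟨h1, h2.trans hu.2⟩, h2⟩⟩
    rw [intervalIntegral.integral_of_le hu.1.le, setIntegral_indicator measurableSet_Iic, hset]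
  rw [hL]
  have hint : Integrable (Function.uncurry fun u t : ℝ => (Iic u).indicator f t) (μ.prod μ) := by
    have he : (Function.uncurry fun u t : ℝ => (Iic u).indicator f t) =
        {p : ℝ × ℝ | p.2 ≤ p.1}.indicator fun p => f p.2 := by
      funext p
      simp only [Function.uncurry, Set.indicator, Set.mem_Iic, Set.mem_setOf_eq]
    rw [he]
    refine (integrable_const M).mono'
      (((hf.comp measurable_snd).indicator (measurableSet_le measurable_snd measurable_fst)).aestronglyMeasurable)
      (Eventually.of_forall fun p => ?_)
    refine (norm_indicator_le_norm_self _ _).trans ?_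
    rw [Real.norm_eq_abs]
    exact hb _
  have hswap : ∫ u, ∫ t, (Iic u).indicator f t ∂μ ∂μ = ∫ t, ∫ u, (Iic u).indicator f t ∂μ ∂μ :=
    integral_integral_swap hint
  rw [hswap]
  refine setIntegral_congr_fun measurableSet_Ioc fun t ht => ?_
  have he : (fun u : ℝ => (Iic u).indicator f t) = fun u => (Ici t).indicator (fun _ => f t) u := by
    funext u
    simp only [Set.indicator, Set.mem_Iic, Set.mem_Ici]
  rw [he, setIntegral_indicator measurableSet_Ici, setIntegral_const]
  have hset : Ioc (0 : ℝ) h ∩ Ici t = Icc t h := by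
    ext u
    simp only [Set.mem_inter_iff, Set.mem_Ioc, Set.mem_Ici, Set.mem_Icc]
    exact ⟨fun ⟨⟨_, h2⟩, h3⟩ => ⟨h3, h2⟩, fun ⟨h3, h2⟩ => ⟨⟨ht.1.trans_le h3, h2⟩, h3⟩⟩
  rw [hset, Measure.real, Real.volume_Icc, ENNReal.toReal_ofReal (by linarith [ht.2]), smul_eq_mul]

/-- **Triangle reduction**: for a bounded measurable `f` and `h ≥ 0`,
`∫₀ʰ ∫₀ʰ f(|r' − r|) dr' dr = 2 ∫₀ʰ (h − t) f(t) dt`. [folklore] -/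
theorem double_integral_abs_eq {f : ℝ → ℝ} (hf : Measurable f) {M : ℝ} (hb : ∀ t, |f t| ≤ M) {h : ℝ} (hh : 0 ≤ h) :
    ∫ r in (0 : ℝ)..h, ∫ r' in (0 : ℝ)..h, f |r' - r| = 2 * ∫ t in (0 : ℝ)..h, (h - t) * f t := by
  set F : ℝ → ℝ := fun u => ∫ t in (0 : ℝ)..u, f t with hF
  have hFc : Continuous F :=
    intervalIntegral.continuous_primitive (fun a b => Literature.Probability.Process.intervalIntegrable_of_bdd hf hb a b) 0
  have h1 : ∫ r in (0 : ℝ)..h, ∫ r' in (0 : ℝ)..h, f |r' - r| = ∫ r in (0 : ℝ)..h, (F r + F (h - r)) := by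
    refine intervalIntegral.integral_congr fun r hr => ?_
    rw [Set.uIcc_of_le hh] at hr
    exact integral_abs_sub_split hf hb hr.1 hr.2
  have hc2 : Continuous fun r : ℝ => F (h - r) := hFc.comp (continuous_const.sub continuous_id)
  have h2 : ∫ r in (0 : ℝ)..h, (F r + F (h - r)) = 2 * ∫ u in (0 : ℝ)..h, F u := by
    rw [intervalIntegral.integral_add (hFc.intervalIntegrable 0 h) (hc2.intervalIntegrable 0 h)]
    have : ∫ r in (0 : ℝ)..h, F (h - r) = ∫ u in (0 : ℝ)..h, F u := by
      rw [intervalIntegral.integral_comp_sub_left (fun u => F u) h]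
      simp
    rw [this]
    ring
  rw [h1, h2, hF, integral_primitive_eq hf hb hh]

/-! ### The covariance is bounded and measurable; the single-integral form of the window variance -/

/-- `|C(t)| ≤ K²` for `|X| ≤ K` and a probability law. [folklore] -/
theorem abs_cov_le (Φ : HardSphereFlow (Torus.geometry (Fin 3)) (hsDiameter σ N) (N + 1))
    [IsProbabilityMeasure (localGibbsLaw σ (fun _ => 1) (fun _ => 0) (fun _ => 1) N Φ)]
    {X : Config (N + 1) (Fin 3) T3 → ℝ} {K : ℝ} (hXb : ∀ z, |X z| ≤ K) (t : ℝ) : |cov Φ X t| ≤ K * K := by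
  have hK : 0 ≤ K := (abs_nonneg _).trans (hXb (Φ.flow 0 (fun _ => (0, 0))))
  unfold cov
  have h := norm_integral_le_of_norm_le_const
    (μ := localGibbsLaw σ (fun _ => 1) (fun _ => 0) (fun _ => 1) N Φ) (C := K * K)
    (f := fun z => X z * X (Φ.flow t z))
    (Eventually.of_forall fun z => by
      rw [Real.norm_eq_abs, abs_mul]
      exact mul_le_mul (hXb _) (hXb _) (abs_nonneg _) hK)
  rw [Real.norm_eq_abs] at h
  simpa using h

/-- `t ↦ C(t)` is measurable (Bochner integral of a jointly measurable modification). [folklore] -/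
theorem measurable_cov (Φ : HardSphereFlow (Torus.geometry (Fin 3)) (hsDiameter σ N) (N + 1))
    [IsProbabilityMeasure (localGibbsLaw σ (fun _ => 1) (fun _ => 0) (fun _ => 1) N Φ)]
    {X : Config (N + 1) (Fin 3) T3 → ℝ} (hX : Measurable X) : Measurable (cov Φ X) := by
  set G := localGibbsLaw σ (fun _ => (1 : ℝ)) (fun _ => (0 : V3)) (fun _ => (1 : ℝ)) N Φ with hGdef
  have hM : Measurable fun p : ℝ × Config (N + 1) (Fin 3) T3 => X p.2 * X (flowMod Φ p) :=
    (hX.comp measurable_snd).mul (hX.comp (measurable_flowMod Φ))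
  have hS : StronglyMeasurable fun t => ∫ z, X z * X (flowMod Φ (t, z)) ∂G :=
    hM.stronglyMeasurable.integral_prod_right'
  have heq : cov Φ X = fun t => ∫ z, X z * X (flowMod Φ (t, z)) ∂G := by
    funext t
    unfold cov
    refine integral_congr_ae ?_
    filter_upwards [ae_mem_good_localGibbsLaw' (N := N) 1 1 0 Φ] with z hz
    rw [flowMod_of_mem Φ hz]
  rw [heq]
  exact hS.measurable

/-- **THE WINDOW-VARIANCE IDENTITY, single-integral form.** For a probability Gibbs law `G_N`, a bounded measurable
observable `X` and `h ≥ 0`: `∫ (∫₀ʰ X(Φ_r z) dr)² dG_N = 2 ∫₀ʰ (h − t) C(t) dt`, `C(t) = ∫ X(z) X(Φ_t z) dG_N`. This is the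
kernel-checked form of `E[(h⁻¹∫₀ʰF)²] = (2/h²)∫₀ʰ(h − t) C_N(t) dt`, i.e. `s·V_N(s) = (2/s)∫₀ˢ(s − u) c_N(u) du` in kinetic units.
[folklore] -/
theorem integral_sq_window_eq_single (Φ : HardSphereFlow (Torus.geometry (Fin 3)) (hsDiameter σ N) (N + 1))
    [IsProbabilityMeasure (localGibbsLaw σ (fun _ => 1) (fun _ => 0) (fun _ => 1) N Φ)]
    {X : Config (N + 1) (Fin 3) T3 → ℝ} (hX : Measurable X) {K : ℝ} (hXb : ∀ z, |X z| ≤ K) {h : ℝ} (hh : 0 ≤ h) :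
    ∫ z, (∫ r in (0 : ℝ)..h, X (Φ.flow r z)) ^ 2 ∂(localGibbsLaw σ (fun _ => 1) (fun _ => 0) (fun _ => 1) N Φ) =
      2 * ∫ t in (0 : ℝ)..h, (h - t) * cov Φ X t := by
  rw [integral_sq_window_eq_double Φ hX hXb hh]
  exact double_integral_abs_eq (measurable_cov Φ hX) (abs_cov_le Φ hXb) hh

end BoltzmannGreenKuboWindowCovariance

end Summit.AtomisticToContinuum.HydrodynamicLimit.Theorems

end
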